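/-
Copyright (c) 2026 the pub-hodgecm-mathlib formalisation cell (harness21).  Prover seat hodgecm-mathlib-R90-C14-p04 (g0), HCML SLAB R90-TF,
section S4 «Ch. 13.1–2» (dealer `K2E2-plan (g6)`), ROAD «KEYS2-ANALYTIC» of R90-C131-p05 (g0) (memo `MEMO-KEYS2-analytic-road.v1.md` e8546b45370d4f86), brick (β).
2026-09-04.
-/
import Summits.HodgeConjecture.HodgeConjecture.Theorems.F0P3cStCharTSKeys3SplitTestDatum        -- ★ §1 GENERIC `normalizedJacquet_mk_eq_smul_iff_integral_cellFun_eq_zero` (the split test at the open cell of `i_P^G χ`); brings ★ T3, ★ `exists_cmPrincipalSeries_toFun_one_eq_zero_and_integral_cellFun_ne_zero`, ★ `isLimitOfCompactOpen_cmBorelTriple_N`, ★ `IsLimitOfCompactOpen.isMulRightInvariant`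
import Summits.HodgeConjecture.HodgeConjecture.Theorems.F0P3bU2PrincipalSeriesJacquetRankLeTwo     -- ★ (Supp)₂ `hasCompactSupport_cellFun_cmBorel_two`; brings ★ `u2LocalBruhatDecomposition`, ★ `finrank_le_of_forall_mem_iff_exists_toFun_one_eq_zero_normalizedInd`
import Literature.NumberTheory.Automorphic.CMPrincipalSeriesJacquetEvalOne                        -- ★ `continuous_torusCharPair_apply`
import HarnessLib

/-!
# R90-TF · S4 «Ch. 13.1–2», ROAD «KEYS2-ANALYTIC» brick (β): «JACQUET SPLIT TEST @ CM DATUM» for `i_G(χ)` on `U(Φ₂)(L⁺_v)`, `v` non-split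
# (`Theorems/R90S4Keys2SplitTest.lean`: for `m ∈ T` and ANY section `f₀`, **`r_B(m)[f₀] = χ(m)·[f₀]` ⟺ `∫_N (δ_B^{-1/2}(m)·(m·f₀) − χ(m)·f₀)(w₀ n) dn = 0`**)
# [BernsteinZelevinsky1977 Prop. 1.9 (a), §2.3, §5 (5.2); Casselman1995 §3.2, §6.3, Lemma 7.1.1 (a); Keys1984 §7; Rogawski1990 §12.1 p. 171]

Cell `hodgecm-mathlib`, crux H413 (`stmt-HodgeConjecture-24833`, lane `--supports … --as helper`), route of record `HCCMUnconditional`; programme R90-TF,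
section S4 = Ch. 13.1–2 (dealer `K2E2-plan (g6)`), seat R90-C14-p04 (g0) (take BY DEFAULT of brick (β), R90 bus 22:27:15Z, on R90-C131-p04 (g0)'s 22:26:46Z offer);
ROAD «KEYS2-ANALYTIC» (holder R90-C131-p05 (g0), memo `R90/R90-C131-p05/g0/MEMO-KEYS2-analytic-road.v1.md` e8546b45370d4f86 § BRICKS (β)) = the in-house
discharge of the sub-sub-socket (RED) `stub_R90_S4_U2_ldsRed` of S4#B7′.  THIS FILE = the PORT TO `N = 2` of ★ `F0P3cStCharTSKeys3SplitTestDatum` §2–§3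
(seat F0P2-p01 (g26), road «KEYS3-ANALYTIC»), whose §1 is GENERIC and is IMPORTED, not copied.  THEOREMS ONLY (0 def ∕ 0 instance ∕ 0 notation ∕ 0 sorry);
★-only imports.  Nothing here is specific to the KEYS2 character: the file is the ORGAN GLUE between the algebraic end (brick (α) `R90S4Keys2JacquetSemisimple.
secondEigenfunctional_of_one_vector_two`, hypothesis `hJf₀ : ∀ m, r_B(m)[f₀] = χ(m)·[f₀]`) and the analytic end (bricks (ε1) (ε2): the cell integrals vanish).

WHAT.  ★ §1 `normalizedJacquet_mk_eq_smul_iff_integral_cellFun_eq_zero` is the split test «`r_P(m)[f₀] = χ(m)[f₀]` ⟺ `∫_N (δ_P^{-1/2}(m)·ρ(m)f₀ − χ(m)·f₀)(w₀ n) dμ = 0`»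
for `ρ = i_P^G χ` under three hypotheses (`hcs` compact support of the cell functions of `ker ev₁`, `hfin` their classes span at most a line of the Jacquet module,
`hΦ` an open-cell section with non-zero cell integral).  At `G = U(Φ₂)(L⁺_v)`, `v` NON-SPLIT, the three are ★:
* **`finrank_le_one_cmPrincipalSeries_two`** — the `(U)₂` block «the open-cell part of `r_B i_G(χ)` is at most a line» (★ `finrank_le_of_forall_mem_iff_exists_toFun_one_eq_zero_normalizedInd`
  over ★ `u2LocalBruhatDecomposition` `U(Φ₂) = B ⊔ B w₀ N` + ★ (Supp)₂ `hasCompactSupport_cellFun_cmBorel_two` + ★ `isLimitOfCompactOpen_cmBorelTriple_N`; the `N = 2` twin of ★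
  `finrank_le_one_cmPrincipalSeries`, extracted from the `HU` step of ★ `u2PrincipalSeries_jacquetFiltration` ∕ ★ `finiteDimensional_finrank_coinvariants_cmPrincipalSeries_two_le_two`);
* **`cm_two_normalizedJacquet_mk_eq_smul_iff_integral_cellFun_eq_zero`** — §1 at the datum (`χ` continuous, `w₀` of matrix `Φ₂`, `μ` ANY Haar measure of `N(L⁺_v)`, which is unimodular ★);
* **`pair_two_normalizedJacquet_mk_eq_smul_iff_integral_cellFun_eq_zero`** — the pair `χ = torusCharPair σ Φ₂ hΦ 0 χ₁ χ₂` (LEFT side = the `hJf₀ m` binder of brick (α) VERBATIM);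
* **`pair_two_normalizedJacquet_mk_eq_smul_of_forall_integral_eq_zero`** — the DOCKING FORM «all the cell integrals vanish ⟹ `hJf₀`» (consumed by brick (ζ) `R90S4Keys2AnalyticHalf`).
HONEST LABEL: HC_CM is proved only modulo the 7 printed citations (2 remaining named inputs: hLiu418 = `stmt-HodgeConjecture-24832`, h413 = `stmt-HodgeConjecture-24833`) until rung 0
closes; count-neutral organ glue; proves no printed statement by itself.

## Tree search
★ `normalizedJacquet_mk_eq_smul_iff_integral_cellFun_eq_zero` (generic §1, `F0P3cStCharTSKeys3SplitTestDatum`); ★ `hasCompactSupport_cellFun_cmBorel_two`, ★ `u2LocalBruhatDecomposition`,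
★ `Representation.finrank_le_of_forall_mem_iff_exists_toFun_one_eq_zero_normalizedInd`, ★ `isLimitOfCompactOpen_cmBorelTriple_N`, ★ `IsLimitOfCompactOpen.isMulRightInvariant`,
★ `exists_cmPrincipalSeries_toFun_one_eq_zero_and_integral_cellFun_ne_zero L 2 v le_rfl`, ★ `continuous_torusCharPair_apply`, ★ `locallyCompactSpace_cmBorelU`, ★ `locallyCompactSpace_local`,
★ `secondCountableTopology_local`, ★ `isClosed_upperUnitriangular`.  Dedup: `rg "cmPrincipalSeries_two|cm_two_normalizedJacquet|pair_two_normalizedJacquet"` over `lean/` — only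
★ `finiteDimensional_finrank_coinvariants_cmPrincipalSeries_two_le_two` (different statement: `dim r_B ≤ 2`).

## References
* [BernsteinZelevinsky1977] I. N. Bernstein, A. V. Zelevinsky, *Induced representations of reductive p-adic groups I*, Ann. Sci. ÉNS 10 (1977), Prop. 1.9 (a), §2.3, Geometrical Lemma 2.12, §5 (5.2).
* [Casselman1995] W. Casselman, *Introduction to the theory of admissible representations of p-adic reductive groups* (1995), §3.2 Prop. 3.2.3, §6.3, Lemma 7.1.1 (a).
* [Keys1984] D. Keys, *Principal series representations of special unitary groups over local fields*, Compositio Math. 51 (1984), §7 Thm. (1).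
* [Rogawski1990] J. D. Rogawski, *Automorphic Representations of Unitary Groups in Three Variables*, Ann. of Math. Stud. 123 (1990), §12.1 p. 171 (`U(1,1) × U(1)`), §12.2 pp. 173–174.
-/

set_option autoImplicit false
-- the mandated namespace has the single-problem summit's repeated segment (`HodgeConjecture.HodgeConjecture`)
set_option linter.dupNamespace false

noncomputable section

open MeasureTheory
open Literature.NumberTheory.Automorphic Literature.NumberTheory.Automorphic.UnitaryGroup
open Summit.HodgeConjecture.HodgeConjecture.Cruxes.H413.F0P3cStCharTSJacquetSplitTest
open Summit.HodgeConjecture.HodgeConjecture.Cruxes.H413.F0P3cStCharTSKeys3SplitTestDatum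
open Summit.HodgeConjecture.HodgeConjecture.Cruxes.H413.F0P3bU2PrincipalSeriesJacquetRankLeTwo

namespace Summit.HodgeConjecture.HodgeConjecture.R90.S4

/-! ## §1 `(U)₂`: the open-cell part of `r_B i_G(χ)` on `U(Φ₂)(L⁺_v)` is at most a line -/

section OpenCell

open NumberField IsDedekindDomain
open scoped MatrixGroups

variable (L : Type) [Field L] [NumberField L] [IsCMField L]

set_option synthInstance.maxHeartbeats 400000 in  -- instance paths on the CM carrier `∏_{w ∣ v} L_w` (as ★ `finiteDimensional_finrank_coinvariants_cmPrincipalSeries_two_le_two`)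
set_option maxHeartbeats 2000000 in  -- the `rfl`-bridge `cmPrincipalSeries L 2 v χ = normalizedInd (cmBorelTriple L 2 v) (𝟙 ⊗ χ)` (cf. ★ `finrank_le_one_cmPrincipalSeries`, 2 M)
/-- **OPEN-CELL BOUND FOR `r_B i_G(χ)`, `G = U(Φ₂)(L⁺_v)` AT A NON-SPLIT PLACE** (the `N = 2` twin of ★ `finrank_le_one_cmPrincipalSeries`; the `(U)₂` step of ★
`u2PrincipalSeries_jacquetFiltration`, by name): for every character `χ` of `T(L⁺_v)` and the subspace `ℓ ≤ r_B i_G(χ)` of classes of sections vanishing at `1`,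
`ℓ` is finite-dimensional with `finrank ℓ ≤ 1` — ★ `finrank_le_of_forall_mem_iff_exists_toFun_one_eq_zero_normalizedInd` over `U(Φ₂) = B ⊔ B w₀ N`
(★ `u2LocalBruhatDecomposition`), ★ (Supp)₂ `hasCompactSupport_cellFun_cmBorel_two`, ★ `isLimitOfCompactOpen_cmBorelTriple_N`, `dim ℂ = 1`.
[cite: Casselman1995, Lemma 7.1.1 (a); §6.3] [cite: BernsteinZelevinsky1977, §5 (5.2)] [cite: Rogawski1990, §12.1 p. 171] -/
theorem finrank_le_one_cmPrincipalSeries_two (v : HeightOneSpectrum (𝓞 ↥(maximalRealSubfield L)))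
    (hns : ∀ w : PlacesOver L v, IsCMField.complexConj L • w.1 = w.1)
    (χ : ↥(torusU (conjLocal L (IsCMField.complexConj L) v) (cmLocalForm L 2 v)) →* ℂˣ) :
    haveI := locallyCompactSpace_cmBorelU L 2 v
    ∀ ℓ : Submodule ℂ ((cmBorelTriple L 2 v).restrict (cmPrincipalSeries L 2 v χ)).Coinvariants,
      (∀ x, x ∈ ℓ ↔ ∃ f : Representation.SmoothInd (cmBorelTriple L 2 v).P
          (Representation.twist
            (((Representation.trivial ℂ ↥(torusU (conjLocal L (IsCMField.complexConj L) v) (cmLocalForm L 2 v)) ℂ).twist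
              χ).comp (cmBorelTriple L 2 v).proj) (rootDeltaChar (cmBorelTriple L 2 v).P)),
        f.toFun 1 = 0 ∧ Representation.Coinvariants.mk _ f = x) →
      FiniteDimensional ℂ ↥ℓ ∧ Module.finrank ℂ ↥ℓ ≤ 1 := by
  haveI := locallyCompactSpace_cmBorelU L 2 v
  intro ℓ hℓ
  -- Bruhat (stepwise: the one-shot `obtain` is slow at `isDefEq`, cf. ★ `finrank_le_one_of_hasCompactSupport_cellFun`)
  have H0 := u2LocalBruhatDecomposition L v
  have H1 := H0 hns
  obtain ⟨w₀, hval, -, hBruhat, -⟩ := H1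
  have hB : ∀ g : ↥(unitaryGroupOfForm (conjLocal L (IsCMField.complexConj L) v) (cmLocalForm L 2 v)),
      g ∈ (cmBorelTriple L 2 v).P ∨ ∃ p ∈ (cmBorelTriple L 2 v).P, ∃ n ∈ (cmBorelTriple L 2 v).N, g = p * w₀ * n := hBruhat
  -- (Supp)₂
  have hS : ∀ f : Representation.SmoothInd (cmBorelTriple L 2 v).P
      (Representation.twist
        ((((Representation.trivial ℂ ↥(torusU (conjLocal L (IsCMField.complexConj L) v) (cmLocalForm L 2 v)) ℂ).twist
          χ)).comp (cmBorelTriple L 2 v).proj) (rootDeltaChar (cmBorelTriple L 2 v).P)),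
      f.toFun 1 = 0 → HasCompactSupport fun n : ↥(cmBorelTriple L 2 v).N =>
        f.toFun (w₀ * (n : ↥(unitaryGroupOfForm (conjLocal L (IsCMField.complexConj L) v) (cmLocalForm L 2 v)))) :=
    fun f hf => hasCompactSupport_cellFun_cmBorel_two L v hns w₀ hval _ f hf
  have hN := isLimitOfCompactOpen_cmBorelTriple_N L 2 v
  -- (U) `finrank ℓ ≤ dim ℂ = 1`, in the `normalizedInd` spelling of ★ `cmPrincipalSeries` (definitional)
  have HU := Representation.finrank_le_of_forall_mem_iff_exists_toFun_one_eq_zero_normalizedInd (cmBorelTriple L 2 v)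
    ((Representation.trivial ℂ ↥(torusU (conjLocal L (IsCMField.complexConj L) v) (cmLocalForm L 2 v)) ℂ).twist χ) w₀ hN hB hS ℓ hℓ
  obtain ⟨hfd, hle⟩ := HU
  refine ⟨hfd, ?_⟩
  have hle' : Module.finrank ℂ ↥ℓ ≤ Module.finrank ℂ ℂ := hle
  have h1 : Module.finrank ℂ ℂ = 1 := Module.finrank_self ℂ
  omega

end OpenCell

/-! ## §2 `U(Φ₂)(L⁺_v)`, `v` non-split: the three hypotheses of the generic split test are ★ -/

section CM

open NumberField IsDedekindDomain

variable (L : Type) [Field L] [NumberField L] [IsCMField L] (v : HeightOneSpectrum (𝓞 ↥(maximalRealSubfield L)))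
  (hns : ∀ w : PlacesOver L v, IsCMField.complexConj L • w.1 = w.1)

include hns in
set_option synthInstance.maxHeartbeats 400000 in
set_option maxHeartbeats 8000000 in
-- statement-heavy: the `SmoothInd` carrier of `cmPrincipalSeries` (class of ★ `cm_normalizedJacquet_mk_eq_smul_iff_integral_cellFun_eq_zero`, its `N = 3` twin)
/-- **«JACQUET SPLIT TEST @ CM DATUM», `N = 2`.**  `G = U(Φ₂)(L⁺_v)`, `v` NON-SPLIT, `χ` a continuous character of `T(L⁺_v)`, `w₀ ∈ G` of matrix `Φ₂` (★ `exists_weylElt_two` ∕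
★ `u2LocalBruhatDecomposition`), `μ` ANY Haar measure of `N(L⁺_v)` (Borel structure given), `m ∈ T`, `f₀ ∈ i_G(χ)` ANY section:
**`r_B(m)[f₀] = χ(m)·[f₀]` ⟺ `∫_N (δ_B^{-1/2}(m)·(m·f₀) − χ(m)·f₀)(w₀ n) dμ(n) = 0`** (★ generic §1 with ★ (Supp)₂, `finrank_le_one_cmPrincipalSeries_two`, ★ the standard open-cell
section; `N(L⁺_v)` is unimodular ★, so `μ` is right invariant).  The `N = 2` twin of ★ `cm_normalizedJacquet_mk_eq_smul_iff_integral_cellFun_eq_zero`.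
[cite: Casselman1995, Lemma 7.1.1 (a), §6.3] [cite: BernsteinZelevinsky1977, Prop. 1.9 (a), §2.3] [cite: Rogawski1990, §12.1 p. 171] -/
theorem cm_two_normalizedJacquet_mk_eq_smul_iff_integral_cellFun_eq_zero
    (χ : ↥(torusU (conjLocal L (IsCMField.complexConj L) v) (cmLocalForm L 2 v)) →* ℂˣ) (hχ : Continuous fun x => ((χ x : ℂˣ) : ℂ))
    (w₀ : ↥(unitaryGroupOfForm (conjLocal L (IsCMField.complexConj L) v) (cmLocalForm L 2 v)))
    (hw₀ : Units.val (w₀ : GL (Fin 2) (LocalRing L v)) = cmLocalForm L 2 v)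
    [MeasurableSpace ↥(cmBorelTriple L 2 v).N] [BorelSpace ↥(cmBorelTriple L 2 v).N]
    (μ : Measure ↥(cmBorelTriple L 2 v).N) [μ.IsHaarMeasure]
    (m : ↥(cmBorelTriple L 2 v).M)
    (f₀ : haveI := locallyCompactSpace_cmBorelU L 2 v
      Representation.SmoothInd (cmBorelTriple L 2 v).P
        (Representation.twist (((Representation.trivial ℂ ↥(torusU (conjLocal L (IsCMField.complexConj L) v) (cmLocalForm L 2 v)) ℂ).twist
          χ).comp (cmBorelTriple L 2 v).proj) (rootDeltaChar (cmBorelTriple L 2 v).P))) :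
    haveI := locallyCompactSpace_cmBorelU L 2 v
    (cmPrincipalSeries L 2 v χ).normalizedJacquet (cmBorelTriple L 2 v) m
          (Representation.Coinvariants.mk ((cmBorelTriple L 2 v).restrict (cmPrincipalSeries L 2 v χ)) f₀) =
        ((χ m : ℂˣ) : ℂ) • Representation.Coinvariants.mk ((cmBorelTriple L 2 v).restrict (cmPrincipalSeries L 2 v χ)) f₀ ↔
      ∫ n : ↥(cmBorelTriple L 2 v).N,
          ((((rootDeltaChar (cmBorelTriple L 2 v).P (Subgroup.inclusion (cmBorelTriple L 2 v).M_le m))⁻¹ : ℂˣ) : ℂ) •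
              cmPrincipalSeries L 2 v χ (m : ↥(unitaryGroupOfForm (conjLocal L (IsCMField.complexConj L) v) (cmLocalForm L 2 v))) f₀ -
            ((χ m : ℂˣ) : ℂ) • f₀).toFun
            ((w₀ : ↥(unitaryGroupOfForm (conjLocal L (IsCMField.complexConj L) v) (cmLocalForm L 2 v))) * n) ∂μ = 0 := by
  haveI := locallyCompactSpace_cmBorelU L 2 v
  haveI : LocallyCompactSpace ↥(unitaryGroupOfForm (conjLocal L (IsCMField.complexConj L) v) (cmLocalForm L 2 v)) :=
    locallyCompactSpace_local (IsCMField.complexConj L) 2 _ v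
  have hNcl : IsClosed ((cmBorelTriple L 2 v).N : Set ↥(unitaryGroupOfForm (conjLocal L (IsCMField.complexConj L) v) (cmLocalForm L 2 v))) :=
    (isClosed_upperUnitriangular (n := 2) (R := LocalRing L v)).preimage continuous_subtype_val
  haveI : LocallyCompactSpace ↥(cmBorelTriple L 2 v).N := hNcl.isClosedEmbedding_subtypeVal.locallyCompactSpace
  haveI : SecondCountableTopology ↥(unitaryGroupOfForm (conjLocal L (IsCMField.complexConj L) v) (cmLocalForm L 2 v)) :=
    secondCountableTopology_local (IsCMField.complexConj L) 2 _ v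
  haveI : SecondCountableTopology ↥(cmBorelTriple L 2 v).N := TopologicalSpace.Subtype.secondCountableTopology _
  have hN := isLimitOfCompactOpen_cmBorelTriple_N L 2 v
  haveI : μ.IsMulRightInvariant := hN.isMulRightInvariant μ
  have hcs : ∀ f : Representation.SmoothInd (cmBorelTriple L 2 v).P
      (Representation.twist (((Representation.trivial ℂ ↥(torusU (conjLocal L (IsCMField.complexConj L) v) (cmLocalForm L 2 v)) ℂ).twist
        χ).comp (cmBorelTriple L 2 v).proj) (rootDeltaChar (cmBorelTriple L 2 v).P)),
      f.toFun 1 = 0 → HasCompactSupport fun n : ↥(cmBorelTriple L 2 v).N =>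
        f.toFun ((w₀ : ↥(unitaryGroupOfForm (conjLocal L (IsCMField.complexConj L) v) (cmLocalForm L 2 v))) * n) :=
    fun f hf => hasCompactSupport_cellFun_cmBorel_two L v hns w₀ hw₀ _ f hf
  have hfin := finrank_le_one_cmPrincipalSeries_two L v hns χ
  have hΦ : ∃ Φ : Representation.SmoothInd (cmBorelTriple L 2 v).P
      (Representation.twist (((Representation.trivial ℂ ↥(torusU (conjLocal L (IsCMField.complexConj L) v) (cmLocalForm L 2 v)) ℂ).twist
        χ).comp (cmBorelTriple L 2 v).proj) (rootDeltaChar (cmBorelTriple L 2 v).P)),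
      Φ.toFun 1 = 0 ∧ ∫ n : ↥(cmBorelTriple L 2 v).N,
        Φ.toFun ((w₀ : ↥(unitaryGroupOfForm (conjLocal L (IsCMField.complexConj L) v) (cmLocalForm L 2 v))) * n) ∂μ ≠ 0 := by
    obtain ⟨Φ, hΦ1, -, hΦ3⟩ := exists_cmPrincipalSeries_toFun_one_eq_zero_and_integral_cellFun_ne_zero L 2 v le_rfl χ hχ w₀ hw₀ μ
    exact ⟨Φ, hΦ1, hΦ3⟩
  -- unfold ★ `cmPrincipalSeries` ∕ ★ `principalSeries` to the `normalizedInd` spelling of the generic §1 (definitional, `dsimp`)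
  dsimp only [UnitaryGroup.cmPrincipalSeries, UnitaryGroup.principalSeries] at hfin ⊢
  exact normalizedJacquet_mk_eq_smul_iff_integral_cellFun_eq_zero (cmBorelTriple L 2 v) χ _ μ hN hcs hfin hΦ m f₀

end CM

/-! ## §3 The pair `χ = (χ₁, χ₂)` (★ `torusCharPair σ Φ₂ hΦ 0 χ₁ χ₂`): the `hJf₀` binder of brick (α), verbatim -/

section Pair

open NumberField IsDedekindDomain

variable (L : Type) [Field L] [NumberField L] [IsCMField L] (v : HeightOneSpectrum (𝓞 ↥(maximalRealSubfield L)))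
  (hns : ∀ w : PlacesOver L v, IsCMField.complexConj L • w.1 = w.1)

include hns in
set_option synthInstance.maxHeartbeats 400000 in
set_option maxHeartbeats 8000000 in
-- statement-heavy: the `SmoothInd` carrier of `cmPrincipalSeries` (class of ★ `pair_normalizedJacquet_mk_eq_smul_iff_integral_cellFun_eq_zero`, its `N = 3` twin)
/-- **The split test for `i_G(χ₁, χ₂)` on `U(Φ₂)(L⁺_v)`** (`χ₁`, `χ₂` continuous; `v` non-split; `w₀` of matrix `Φ₂`; `μ` any Haar measure of `N(L⁺_v)`; `χ = torusCharPair σ Φ₂ hΦ 0 χ₁ χ₂`):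
for every `m ∈ T` and every section `f₀`, `r_B(m)[f₀] = χ(m)·[f₀]` — the `hJf₀ m` binder of brick (α) `secondEigenfunctional_of_one_vector_two`, VERBATIM — iff the cell
integral of `δ_B^{-1/2}(m)·(m·f₀) − χ(m)·f₀` vanishes.  [cite: Casselman1995, Lemma 7.1.1 (a), §6.3] [cite: Keys1984, §7 Thm. (1)] [cite: Rogawski1990, §12.1 p. 171] -/
theorem pair_two_normalizedJacquet_mk_eq_smul_iff_integral_cellFun_eq_zero
    (χ₁ : (LocalRing L v)ˣ →* ℂˣ) (χ₂ : ↥(normOneUnits (conjLocal L (IsCMField.complexConj L) v)) →* ℂˣ)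
    (h₁ : Continuous fun x => ((χ₁ x : ℂˣ) : ℂ)) (h₂ : Continuous fun x => ((χ₂ x : ℂˣ) : ℂ))
    (w₀ : ↥(unitaryGroupOfForm (conjLocal L (IsCMField.complexConj L) v) (cmLocalForm L 2 v)))
    (hw₀ : Units.val (w₀ : GL (Fin 2) (LocalRing L v)) = cmLocalForm L 2 v)
    [MeasurableSpace ↥(cmBorelTriple L 2 v).N] [BorelSpace ↥(cmBorelTriple L 2 v).N]
    (μ : Measure ↥(cmBorelTriple L 2 v).N) [μ.IsHaarMeasure]
    (m : ↥(cmBorelTriple L 2 v).M)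
    (f₀ : haveI := locallyCompactSpace_cmBorelU L 2 v
      Representation.SmoothInd (cmBorelTriple L 2 v).P
        (Representation.twist (((Representation.trivial ℂ ↥(torusU (conjLocal L (IsCMField.complexConj L) v) (cmLocalForm L 2 v)) ℂ).twist
          (torusCharPair (conjLocal L (IsCMField.complexConj L) v) (cmLocalForm L 2 v) (cmLocalForm_eq_over L 2 v) 0 χ₁ χ₂)).comp
            (cmBorelTriple L 2 v).proj) (rootDeltaChar (cmBorelTriple L 2 v).P))) :
    haveI := locallyCompactSpace_cmBorelU L 2 v
    (cmPrincipalSeries L 2 v (torusCharPair (conjLocal L (IsCMField.complexConj L) v) (cmLocalForm L 2 v) (cmLocalForm_eq_over L 2 v) 0 χ₁ χ₂)).normalizedJacquet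
          (cmBorelTriple L 2 v) m
          (Representation.Coinvariants.mk ((cmBorelTriple L 2 v).restrict (cmPrincipalSeries L 2 v
            (torusCharPair (conjLocal L (IsCMField.complexConj L) v) (cmLocalForm L 2 v) (cmLocalForm_eq_over L 2 v) 0 χ₁ χ₂))) f₀) =
        ((torusCharPair (conjLocal L (IsCMField.complexConj L) v) (cmLocalForm L 2 v) (cmLocalForm_eq_over L 2 v) 0 χ₁ χ₂ m : ℂˣ) : ℂ) •
          Representation.Coinvariants.mk ((cmBorelTriple L 2 v).restrict (cmPrincipalSeries L 2 v
            (torusCharPair (conjLocal L (IsCMField.complexConj L) v) (cmLocalForm L 2 v) (cmLocalForm_eq_over L 2 v) 0 χ₁ χ₂))) f₀ ↔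
      ∫ n : ↥(cmBorelTriple L 2 v).N,
          ((((rootDeltaChar (cmBorelTriple L 2 v).P (Subgroup.inclusion (cmBorelTriple L 2 v).M_le m))⁻¹ : ℂˣ) : ℂ) •
              cmPrincipalSeries L 2 v (torusCharPair (conjLocal L (IsCMField.complexConj L) v) (cmLocalForm L 2 v) (cmLocalForm_eq_over L 2 v) 0 χ₁ χ₂)
                (m : ↥(unitaryGroupOfForm (conjLocal L (IsCMField.complexConj L) v) (cmLocalForm L 2 v))) f₀ -
            ((torusCharPair (conjLocal L (IsCMField.complexConj L) v) (cmLocalForm L 2 v) (cmLocalForm_eq_over L 2 v) 0 χ₁ χ₂ m : ℂˣ) : ℂ) • f₀).toFun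
            ((w₀ : ↥(unitaryGroupOfForm (conjLocal L (IsCMField.complexConj L) v) (cmLocalForm L 2 v))) * n) ∂μ = 0 :=
  cm_two_normalizedJacquet_mk_eq_smul_iff_integral_cellFun_eq_zero L v hns
    (torusCharPair (conjLocal L (IsCMField.complexConj L) v) (cmLocalForm L 2 v) (cmLocalForm_eq_over L 2 v) 0 χ₁ χ₂)
    (continuous_torusCharPair_apply (conjLocal L (IsCMField.complexConj L) v) (cmLocalForm L 2 v) (cmLocalForm_eq_over L 2 v) 0 χ₁ χ₂ h₁ h₂)
    w₀ hw₀ μ m f₀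

include hns in
set_option synthInstance.maxHeartbeats 400000 in
set_option maxHeartbeats 8000000 in
-- statement-heavy: the `SmoothInd` carrier of `cmPrincipalSeries` (class of ★ `pair_normalizedJacquet_mk_eq_smul_of_forall_integral_eq_zero`, its `N = 3` twin)
/-- **DOCKING FORM, `N = 2`: «all the cell integrals vanish ⟹ `hJf₀`».**  If, for ONE Haar measure `μ` of `N(L⁺_v)` and the element `w₀` of matrix `Φ₂`, the cell integral of
`δ_B^{-1/2}(m)·(m·f₀) − χ(m)·f₀` vanishes for every `m ∈ T` (`χ = torusCharPair σ Φ₂ hΦ 0 χ₁ χ₂`), then `r_B(m)[f₀] = χ(m)·[f₀]` for every `m ∈ T` — the hypothesis `hJf₀` of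
brick (α) `secondEigenfunctional_of_one_vector_two` (with `f₀(1) = 1` and `wχ = χ` there this is `hSecond_two`, i.e. the sub-sub-socket (RED) `stub_R90_S4_U2_ldsRed` in house via
brick (ζ)).  [cite: Keys1984, §7 Thm. (1)] [cite: Casselman1995, Lemma 7.1.1 (a)] [cite: Rogawski1990, §12.1 p. 171; §12.2 (3) pp. 173–174] -/
theorem pair_two_normalizedJacquet_mk_eq_smul_of_forall_integral_eq_zero
    (χ₁ : (LocalRing L v)ˣ →* ℂˣ) (χ₂ : ↥(normOneUnits (conjLocal L (IsCMField.complexConj L) v)) →* ℂˣ)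
    (h₁ : Continuous fun x => ((χ₁ x : ℂˣ) : ℂ)) (h₂ : Continuous fun x => ((χ₂ x : ℂˣ) : ℂ))
    (w₀ : ↥(unitaryGroupOfForm (conjLocal L (IsCMField.complexConj L) v) (cmLocalForm L 2 v)))
    (hw₀ : Units.val (w₀ : GL (Fin 2) (LocalRing L v)) = cmLocalForm L 2 v)
    [MeasurableSpace ↥(cmBorelTriple L 2 v).N] [BorelSpace ↥(cmBorelTriple L 2 v).N]
    (μ : Measure ↥(cmBorelTriple L 2 v).N) [μ.IsHaarMeasure]
    (f₀ : haveI := locallyCompactSpace_cmBorelU L 2 v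
      Representation.SmoothInd (cmBorelTriple L 2 v).P
        (Representation.twist (((Representation.trivial ℂ ↥(torusU (conjLocal L (IsCMField.complexConj L) v) (cmLocalForm L 2 v)) ℂ).twist
          (torusCharPair (conjLocal L (IsCMField.complexConj L) v) (cmLocalForm L 2 v) (cmLocalForm_eq_over L 2 v) 0 χ₁ χ₂)).comp
            (cmBorelTriple L 2 v).proj) (rootDeltaChar (cmBorelTriple L 2 v).P)))
    (hint : haveI := locallyCompactSpace_cmBorelU L 2 v
      ∀ m : ↥(cmBorelTriple L 2 v).M,
        ∫ n : ↥(cmBorelTriple L 2 v).N,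
          ((((rootDeltaChar (cmBorelTriple L 2 v).P (Subgroup.inclusion (cmBorelTriple L 2 v).M_le m))⁻¹ : ℂˣ) : ℂ) •
              cmPrincipalSeries L 2 v (torusCharPair (conjLocal L (IsCMField.complexConj L) v) (cmLocalForm L 2 v) (cmLocalForm_eq_over L 2 v) 0 χ₁ χ₂)
                (m : ↥(unitaryGroupOfForm (conjLocal L (IsCMField.complexConj L) v) (cmLocalForm L 2 v))) f₀ -
            ((torusCharPair (conjLocal L (IsCMField.complexConj L) v) (cmLocalForm L 2 v) (cmLocalForm_eq_over L 2 v) 0 χ₁ χ₂ m : ℂˣ) : ℂ) • f₀).toFun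
            ((w₀ : ↥(unitaryGroupOfForm (conjLocal L (IsCMField.complexConj L) v) (cmLocalForm L 2 v))) * n) ∂μ = 0) :
    haveI := locallyCompactSpace_cmBorelU L 2 v
    ∀ m : ↥(cmBorelTriple L 2 v).M,
      (cmPrincipalSeries L 2 v (torusCharPair (conjLocal L (IsCMField.complexConj L) v) (cmLocalForm L 2 v) (cmLocalForm_eq_over L 2 v) 0 χ₁ χ₂)).normalizedJacquet
          (cmBorelTriple L 2 v) m
          (Representation.Coinvariants.mk ((cmBorelTriple L 2 v).restrict (cmPrincipalSeries L 2 v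
            (torusCharPair (conjLocal L (IsCMField.complexConj L) v) (cmLocalForm L 2 v) (cmLocalForm_eq_over L 2 v) 0 χ₁ χ₂))) f₀) =
        ((torusCharPair (conjLocal L (IsCMField.complexConj L) v) (cmLocalForm L 2 v) (cmLocalForm_eq_over L 2 v) 0 χ₁ χ₂ m : ℂˣ) : ℂ) •
          Representation.Coinvariants.mk ((cmBorelTriple L 2 v).restrict (cmPrincipalSeries L 2 v
            (torusCharPair (conjLocal L (IsCMField.complexConj L) v) (cmLocalForm L 2 v) (cmLocalForm_eq_over L 2 v) 0 χ₁ χ₂))) f₀ :=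
  fun m => (pair_two_normalizedJacquet_mk_eq_smul_iff_integral_cellFun_eq_zero L v hns χ₁ χ₂ h₁ h₂ w₀ hw₀ μ m f₀).2 (hint m)

end Pair

end Summit.HodgeConjecture.HodgeConjecture.R90.S4

end
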